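import Summits.Langlands.Langlands.Theses.AnalyticDescent

/-!
# `AnalyticDescent.SectorComplement` (stmt-Langlands-10560) — logical position (SUSPECT-EQUIVALENCE audit)

Crux-strategist unit `cstrat-stmt-Langlands-10560-q1` (2026-08-17). The payload witness
`Theorems.skinnerWilesDefectOne_sectorComplement_iff_of_target` concerns the HOMONYMOUS frame item of route
SkinnerWilesDefectOne (`ReducibleOrdinaryModular → Langlands`, stmt-Langlands-12923), a different statement;
this file records the identical position for THIS route's frame
`SectorComplement : Prop := DescentGL2 → _root_.Langlands`, kernel-checked:

* `ad_sectorComplement_of_langlands`: `Langlands → SectorComplement`;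
* `ad_sectorComplement_iff_of_target`: under the route target `DescentGL2`, `SectorComplement ↔ Langlands`
  (the suspect equivalence, verbatim);
* `ad_sectorComplement_iff_of_cruxes`: under the two ranked cruxes `UnramifiedTwistHolomorphy`,
  `GaloisConverseGL2` (which give `DescentGL2` by pure logic), `SectorComplement ↔ Langlands`;
* `ad_not_sectorComplement_iff`: `¬ SectorComplement ↔ DescentGL2 ∧ ¬ Langlands`;
* `ad_sectorComplement_iff_not_or`: truth table.

`Langlands → DescentGL2` is deliberately absent (not formal: direction (B) of the summit needs
`IsGeometricFramed`, and a.e. Satake matching over the soluble layers does not give de Rham at `ℓ`;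
refuter a3b0799b on stmt-Langlands-2209). Verdict of the audit (EQUIVALENCE-AUDIT_AnalyticDescent.md):
equivalence-benign — the only sibling hypothesis of `closes`, `DescentGL2`, is OPEN and substantive; no
item of the route is proved.
-/

set_option linter.dupNamespace false

namespace Summit.Langlands.Langlands.Cruxes.SectorComplement.EquivalenceAuditAD

open Summit.Langlands.Langlands.Theses.AnalyticDescent

/-- The frame is implied by the summit. [folklore] -/
theorem ad_sectorComplement_of_langlands : _root_.Langlands → SectorComplement :=
  fun h _ ↦ h

/-- Under the route target `DescentGL2` the frame IS the summit. [folklore] -/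
theorem ad_sectorComplement_iff_of_target (hX : DescentGL2) : SectorComplement ↔ _root_.Langlands :=
  ⟨fun hC ↦ hC hX, fun h _ ↦ h⟩

/-- `DescentGL2` from the two ranked cruxes (the route's Assembly logic, restated). [folklore] -/
theorem ad_descentGL2_of_cruxes (hH : UnramifiedTwistHolomorphy) (hC2 : GaloisConverseGL2) :
    DescentGL2 := by
  intro F _ _ ℓ _ ι ρ F' _ _ _ _ hirr hirr' hpot
  exact hC2 F ℓ ι ρ F' hirr hirr' hpot (hH F ℓ ι ρ F' hirr hirr' hpot)

/-- Under the two ranked cruxes the frame is the summit. [folklore] -/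
theorem ad_sectorComplement_iff_of_cruxes (hH : UnramifiedTwistHolomorphy) (hC2 : GaloisConverseGL2) :
    SectorComplement ↔ _root_.Langlands :=
  ad_sectorComplement_iff_of_target (ad_descentGL2_of_cruxes hH hC2)

/-- Exact content of a refutation of the frame: prove the (open) sector theorem AND disprove the
formal summit. [folklore] -/
theorem ad_not_sectorComplement_iff : ¬ SectorComplement ↔ DescentGL2 ∧ ¬ _root_.Langlands :=
  Classical.not_imp

/-- Truth table of the frame. [folklore] -/
theorem ad_sectorComplement_iff_not_or : SectorComplement ↔ ¬ DescentGL2 ∨ _root_.Langlands :=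
  imp_iff_not_or

end Summit.Langlands.Langlands.Cruxes.SectorComplement.EquivalenceAuditAD
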